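import Summits.HodgeConjecture.CorCM.TwoGroupExtraspecialTable
import HarnessLib

/-!
# `C₈ × C₂` of index two with an inverting element: normal forms, the «allowed-conjugate» killers, and a table model on `ℤ/8 × 𝔽₂²`

COR-CM (cell `pub-hodgecm2`), binder seat b04 (gen 36), count-neutral own lane «Galois-CM-type classification».  KERNEL ONLY, pure
group theory: theorems; no definition, no named fact, no `sorry`.  Group-theoretic core of the «element of order `8`» branch
(A7-JUNCTION gen-36 addendum, B2 world) of the order-`32` base of the `2`-power classification: a GOOD Galois CM field `K` of degree
`32` with a central involution `t ≠ c` whose CM quotient `K^⟨t⟩` is of the second GOOD16 kind has `r ∈ Gal(K/ℚ)` of order `8`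
(`r⁴ ∈ {c, ct}`) with all conjugates in `{r, r⁻¹, rt, r⁻¹t}`; then `A = C(r) = ⟨r⟩ × ⟨t⟩` has index `2` and an `x ∉ A` acts on it.

* `exists_pow_mul_pow_of_comm` — `|G| = 32`, `orderOf r = 8`, `t` an involution commuting with `r`, `t ∉ ⟨r⟩`, `r` not central ⟹
  every element commuting with `r` is `rⁱ tʲ` (`i < 8`, `j < 2`) (counting: `C(r)` is proper, so `|C(r)| ≤ 16`).
* `not_allowed_of_eq_mul`, `not_allowed_of_eq_inv_mul` — the KILLERS of the second GOOD16 alternative: if a conjugate of `r₂`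
  (`r₂⁴ ≠ 1`) equals `r₂ s` or `r₂⁻¹ s` with `s` an involution commuting with `t'`, `s ∉ {1, t'}`, then it is not in
  `{r₂, r₂⁻¹, r₂ t', r₂⁻¹ t'}`.
* **`exists_table_inverted`** — `x r = r⁻¹ x`, `x t = t x`, `x² = rᵃ tᵇ`, `x ∉ A`: the word map `(i,j,k) ↦ rⁱ tʲ xᵏ` inverts to a
  TABLE MODEL `e : G ≃ ℤ/8 × 𝔽₂ × 𝔽₂` of the law `(i,j,k)(i',j',k') = (i + 7ᵏ i' + kk'a, j + j' + kk'b, k + k')`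
  (`(a,b) = (0,0)`: `D₁₆ × C₂`; `(4,0)`: `Q₁₆ × C₂`; `(0,1), (4,1)`: `C₈ ⋊₋₁ C₄`), with `e (rⁱ tʲ xᵏ) = (i,j,k)` (so `e r = (1,0,0)`,
  `e t = (0,1,0)`, `e x = (0,0,1)`, `e 1 = 0`); unit and left-inverse identities of the law are hypotheses (`decide`d at concrete
  `(a,b)` by the user).

## References

* [Rotman1995] J. J. Rotman, *An Introduction to the Theory of Groups*, 4th ed., GTM 148, Thm. 5.46 and §5 (groups with a cyclic
  subgroup of index two; context).
-/

namespace Summit.HodgeConjecture.CorCM.GaloisModels.CyclicEight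

open Summit.HodgeConjecture.CorCM.GaloisTableLaws
open Summit.HodgeConjecture.CorCM.GaloisModels.FrattiniTwo (exists_table_equiv_of_words_inv)

variable {G : Type*} [Group G]

/-! ## §1 The killers of the «allowed conjugates» condition -/

/-- If `r₂⁴ ≠ 1` and `s ∉ {1, t'}` is an involution commuting with `t'`, then `r₂ s ∉ {r₂, r₂⁻¹, r₂ t', r₂⁻¹ t'}`.
[folklore] -/
theorem not_allowed_of_eq_mul {r₂ s t' w : G} (hw : w = r₂ * s) (hs1 : s ≠ 1) (hst : s ≠ t') (hss : s * s = 1)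
    (ht : t' * t' = 1) (hst' : s * t' = t' * s) (hr4 : r₂ ^ 4 ≠ 1) :
    ¬ (w = r₂ ∨ w = r₂⁻¹ ∨ w = r₂ * t' ∨ w = r₂⁻¹ * t') := by
  subst hw
  have hsinv : s⁻¹ = s := inv_eq_of_mul_eq_one_right hss
  have key : ∀ z : G, z * z = 1 → r₂ * r₂ = z → r₂ ^ 4 = 1 := fun z hz h => by
    rw [show r₂ ^ 4 = (r₂ * r₂) * (r₂ * r₂) by simp only [pow_succ, pow_zero, one_mul, mul_assoc], h, hz]
  rintro (h | h | h | h)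
  · exact hs1 (mul_left_cancel (h.trans (mul_one r₂).symm))
  · -- `r₂ s = r₂⁻¹` ⟹ `r₂² = s⁻¹ = s`
    apply hr4; apply key s hss
    have h1 : r₂ * (r₂ * s) = 1 := by rw [h, mul_inv_cancel]
    rw [← mul_assoc] at h1
    rw [← hsinv]; exact eq_inv_of_mul_eq_one_left h1
  · exact hst (mul_left_cancel h)
  · -- `r₂ s = r₂⁻¹ t'` ⟹ `r₂² = t' s`
    apply hr4; apply key (t' * s) (by
      calc t' * s * (t' * s) = t' * (s * t') * s := by simp only [mul_assoc]
        _ = t' * (t' * s) * s := by rw [hst']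
        _ = (t' * t') * (s * s) := by simp only [mul_assoc]
        _ = 1 := by rw [ht, hss, one_mul])
    have h1 : r₂ * (r₂ * s) = t' := by rw [h, ← mul_assoc, mul_inv_cancel, one_mul]
    calc r₂ * r₂ = r₂ * (r₂ * s) * s⁻¹ := by simp only [mul_assoc, mul_inv_cancel, mul_one]
      _ = t' * s := by rw [h1, hsinv]

/-- If `r₂⁴ ≠ 1` and `s ∉ {1, t'}` is an involution commuting with `t'`, then `r₂⁻¹ s ∉ {r₂, r₂⁻¹, r₂ t', r₂⁻¹ t'}`.
[folklore] -/
theorem not_allowed_of_eq_inv_mul {r₂ s t' w : G} (hw : w = r₂⁻¹ * s) (hs1 : s ≠ 1) (hst : s ≠ t') (hss : s * s = 1)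
    (ht : t' * t' = 1) (hst' : s * t' = t' * s) (hr4 : r₂ ^ 4 ≠ 1) :
    ¬ (w = r₂ ∨ w = r₂⁻¹ ∨ w = r₂ * t' ∨ w = r₂⁻¹ * t') := by
  subst hw
  have htinv : t'⁻¹ = t' := inv_eq_of_mul_eq_one_right ht
  have key : ∀ z : G, z * z = 1 → r₂ * r₂ = z → r₂ ^ 4 = 1 := fun z hz h => by
    rw [show r₂ ^ 4 = (r₂ * r₂) * (r₂ * r₂) by simp only [pow_succ, pow_zero, one_mul, mul_assoc], h, hz]
  rintro (h | h | h | h)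
  · -- `r₂⁻¹ s = r₂` ⟹ `s = r₂²`
    apply hr4; apply key s hss
    have h1 : s = r₂ * r₂ := by
      have := congrArg (r₂ * ·) h
      simpa only [mul_inv_cancel_left] using this
    exact h1.symm
  · exact hs1 (mul_left_cancel (h.trans (mul_one r₂⁻¹).symm))
  · -- `r₂⁻¹ s = r₂ t'` ⟹ `r₂² = s t'⁻¹ = s t'`
    apply hr4; apply key (s * t') (by
      calc s * t' * (s * t') = s * (t' * s) * t' := by simp only [mul_assoc]
        _ = s * (s * t') * t' := by rw [← hst']
        _ = (s * s) * (t' * t') := by simp only [mul_assoc]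
        _ = 1 := by rw [ht, hss, one_mul])
    have h1 : s = r₂ * (r₂ * t') := by
      have := congrArg (r₂ * ·) h
      simpa only [mul_inv_cancel_left] using this
    calc r₂ * r₂ = r₂ * (r₂ * t') * t'⁻¹ := by simp only [mul_assoc, mul_inv_cancel, mul_one]
      _ = s * t' := by rw [← h1, htinv]
  · exact hst (mul_left_cancel h)

/-! ## §2 The centralizer of `r` -/

/-- **Normal form of `C(r)`**: `|G| = 32`, `orderOf r = 8`, `t` an involution with `t r = r t`, `t ∉ ⟨r⟩`, and `r` not central.
Then every `w` commuting with `r` is `rⁱ tʲ` with `i < 8`, `j < 2`. [folklore] -/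
theorem exists_pow_mul_pow_of_comm [Finite G] (hcard : Nat.card G = 32) {r t x : G} (hr : orderOf r = 8)
    (htr : t ∉ Subgroup.zpowers r) (hrt : r * t = t * r) (hx : x * r ≠ r * x) (w : G) (hw : w * r = r * w) :
    ∃ i j : ℕ, i < 8 ∧ j < 2 ∧ w = r ^ i * t ^ j := by
  classical
  set C := Subgroup.centralizer ({r} : Set G) with hC
  have hmemC : ∀ g : G, g ∈ C ↔ g * r = r * g := fun g => Subgroup.mem_centralizer_singleton_iff
  -- `C` is proper, so `|C| ≤ 16`
  have hCle : Nat.card C ≤ 16 := by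
    have hdvd : Nat.card C ∣ 32 := by rw [← hcard]; exact Subgroup.card_subgroup_dvd_card C
    have hne : Nat.card C ≠ 32 := by
      intro h
      have htop : C = ⊤ := Subgroup.eq_top_of_card_eq C (by rw [h, hcard])
      have : x ∈ C := by rw [htop]; exact Subgroup.mem_top x
      exact hx ((hmemC x).1 this)
    obtain ⟨k, hk, hk'⟩ := (Nat.dvd_prime_pow Nat.prime_two).1 (show Nat.card C ∣ 2 ^ 5 by norm_num; exact hdvd)
    rw [hk']
    have h5 : k ≠ 5 := fun h5 => hne (by rw [hk', h5]; norm_num)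
    have h4 : k ≤ 4 := by omega
    exact le_trans (Nat.pow_le_pow_right (by norm_num) h4) (by norm_num)
  -- the injection `(i, j) ↦ rⁱ tʲ` from `ℤ/8 × 𝔽₂` into `C`
  have hmem : ∀ p : ZMod 8 × ZMod 2, r ^ p.1.val * t ^ p.2.val ∈ C := fun p => by
    rw [hmemC]
    exact (((Commute.refl r).pow_left _).mul_left ((show Commute t r from hrt.symm).pow_left _)).eq
  set f : ZMod 8 × ZMod 2 → C := fun p => ⟨r ^ p.1.val * t ^ p.2.val, hmem p⟩ with hf
  have ht' : ∀ i i' : ℕ, r ^ i * t = r ^ i' → False := by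
    intro i i' h
    apply htr
    have : t = (r ^ i)⁻¹ * r ^ i' := by rw [← h, inv_mul_cancel_left]
    rw [this]
    exact Subgroup.mul_mem _ (Subgroup.inv_mem _ (Subgroup.pow_mem _ (Subgroup.mem_zpowers r) i))
      (Subgroup.pow_mem _ (Subgroup.mem_zpowers r) i')
  have hinj : Function.Injective f := by
    rintro ⟨i, j⟩ ⟨i', j'⟩ h
    simp only [hf, Subtype.mk.injEq] at h
    have hi : ∀ {i i' : ZMod 8}, r ^ i.val = r ^ i'.val → i = i' := by
      intro i i' h
      rw [pow_inj_mod, hr, Nat.mod_eq_of_lt (ZMod.val_lt i), Nat.mod_eq_of_lt (ZMod.val_lt i')] at h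
      exact ZMod.val_injective 8 h
    rcases zmod2_cases j with rfl | rfl <;> rcases zmod2_cases j' with rfl | rfl
    · simp only [ZMod.val_zero, pow_zero, mul_one] at h
      rw [hi h]
    · simp only [ZMod.val_zero, pow_zero, mul_one, show (1 : ZMod 2).val = 1 from rfl, pow_one] at h
      exact (ht' _ _ h.symm).elim
    · simp only [ZMod.val_zero, pow_zero, mul_one, show (1 : ZMod 2).val = 1 from rfl, pow_one] at h
      exact (ht' _ _ h).elim
    · simp only [show (1 : ZMod 2).val = 1 from rfl, pow_one] at h
      rw [hi (mul_right_cancel h)]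
  have hbij : Function.Bijective f := hinj.bijective_of_nat_card_le (by
    rw [Nat.card_prod, Nat.card_zmod, Nat.card_zmod]; omega)
  obtain ⟨⟨i, j⟩, hp⟩ := hbij.2 ⟨w, (hmemC w).2 hw⟩
  have hp' := congrArg Subtype.val hp
  simp only [hf] at hp'
  exact ⟨i.val, j.val, ZMod.val_lt i, ZMod.val_lt j, hp'.symm⟩

/-- The square of an element `x a` of the non-trivial coset: `(x a)² = (x a x⁻¹) · x² · a`. [folklore] -/
theorem mul_sq_eq (x a : G) : x * a * (x * a) = (x * a * x⁻¹) * (x * x) * a := by group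

/-! ## §3 The table model for an inverting `x` -/

/-- **Table model for `⟨r⟩ × ⟨t⟩` extended by an inverting `x`.**  `|G| = 32`, `orderOf r = 8`, `t` an involution commuting with
`r`, `t ∉ ⟨r⟩`; `x` with `x r = r⁻¹ x`, `x t = t x`, `x² = rᵃ tᵇ` (`a ∈ ℤ/8`, `b ∈ 𝔽₂`) and `rⁱ tʲ x ≠ 1`; `mul` an operation on
`ℤ/8 × 𝔽₂ × 𝔽₂` agreeing with `(i,j,k)(i',j',k') = (i + 7ᵏi' + kk'a, j + j' + kk'b, k + k')`, with `mul p 0 = p` and the left-inverse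
identity for `(i,j,0) ↦ (-i,j,0)`, `(i,j,1) ↦ (i+a, j+b, 1)`.  Then the word map `(i,j,k) ↦ rⁱ tʲ xᵏ` inverts to a table model
`e : G ≃ ℤ/8 × 𝔽₂ × 𝔽₂` with `e r = (1,0,0)`, `e t = (0,1,0)`, `e x = (0,0,1)`, `e 1 = 0`. [folklore] -/
theorem exists_table_inverted [Finite G] (hcard : Nat.card G = 32) {r t x : G} (hr : orderOf r = 8) (htt : t * t = 1)
    (htr : t ∉ Subgroup.zpowers r) (hrt : r * t = t * r) (hxr : x * r = r⁻¹ * x) (hxt : x * t = t * x)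
    (a : ZMod 8) (b : ZMod 2) (hxx : x * x = r ^ a.val * t ^ b.val) (hxA : ∀ i j : ℕ, r ^ i * t ^ j * x ≠ 1)
    (mul : ZMod 8 × ZMod 2 × ZMod 2 → ZMod 8 × ZMod 2 × ZMod 2 → ZMod 8 × ZMod 2 × ZMod 2)
    (hm : ∀ p q : ZMod 8 × ZMod 2 × ZMod 2, mul p q =
      (p.1 + (if p.2.2 = 0 then q.1 else 7 * q.1) + (if p.2.2 = 1 ∧ q.2.2 = 1 then a else 0),
        p.2.1 + q.2.1 + (if p.2.2 = 1 ∧ q.2.2 = 1 then b else 0), p.2.2 + q.2.2))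
    (ho : ∀ p : ZMod 8 × ZMod 2 × ZMod 2, mul p (0, 0, 0) = p)
    (hlinv : ∀ p q : ZMod 8 × ZMod 2 × ZMod 2,
      mul (if p.2.2 = 0 then (-p.1, p.2.1, 0) else (p.1 + a, p.2.1 + b, 1)) (mul p q) = q) :
    ∃ e : G ≃ ZMod 8 × ZMod 2 × ZMod 2, (∀ g h : G, e (g * h) = mul (e g) (e h)) ∧
      e r = (1, 0, 0) ∧ e t = (0, 1, 0) ∧ e x = (0, 0, 1) ∧ e 1 = (0, 0, 0) ∧
      ∀ p : ZMod 8 × ZMod 2 × ZMod 2, e (r ^ p.1.val * t ^ p.2.1.val * x ^ p.2.2.val) = p := by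
  have hv0 : (0 : ZMod 2).val = 0 := rfl
  have hv1 : (1 : ZMod 2).val = 1 := rfl
  have hr8 : r ^ 8 = 1 := by rw [← hr]; exact pow_orderOf_eq_one r
  have ht2 : t ^ 2 = 1 := by rw [pow_two, htt]
  have hrinv : r⁻¹ = r ^ 7 := by
    rw [eq_comm, ← mul_eq_one_iff_eq_inv, ← pow_succ, hr8]
  have hxr7 : x * r = r ^ 7 * x := by rw [hxr, hrinv]
  -- commuting powers
  have htr' : ∀ m n : ℕ, t ^ m * r ^ n = r ^ n * t ^ m := fun m n => ((show Commute t r from hrt.symm).pow_pow m n).eq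
  have hxt' : ∀ m : ℕ, x * t ^ m = t ^ m * x := fun m => ((show Commute x t from hxt).pow_right m).eq
  have hxr' : ∀ n : ℕ, x * r ^ n = r ^ (7 * n) * x := s_mul_pow r x 7 hxr7
  -- exponent bookkeeping
  have hval7 : ∀ i' : ZMod 8, (7 * i').val % 8 = 7 * i'.val % 8 := fun i' => by rw [ZMod.val_mul]; exact Nat.mod_mod _ _
  set f : ZMod 8 × ZMod 2 × ZMod 2 → G := fun p => r ^ p.1.val * t ^ p.2.1.val * x ^ p.2.2.val with hf_def
  -- the two shapes of products
  have hA : ∀ (i i' : ZMod 8) (j j' : ZMod 2) (I : ZMod 8) (hI : I.val % 8 = (i.val + i'.val) % 8),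
      r ^ i.val * t ^ j.val * (r ^ i'.val * t ^ j'.val) = r ^ I.val * t ^ (j + j').val := by
    intro i i' j j' I hI
    calc r ^ i.val * t ^ j.val * (r ^ i'.val * t ^ j'.val) = r ^ i.val * (t ^ j.val * r ^ i'.val) * t ^ j'.val := by
          simp only [mul_assoc]
      _ = r ^ i.val * (r ^ i'.val * t ^ j.val) * t ^ j'.val := by rw [htr']
      _ = r ^ (i.val + i'.val) * t ^ (j.val + j'.val) := by rw [pow_add, pow_add]; simp only [mul_assoc]
      _ = r ^ I.val * t ^ (j + j').val := by
          rw [pow_eq_pow_of_mod_eq r hr8 hI.symm, pow_eq_pow_of_mod_eq t ht2 (a := j.val + j'.val) (b := (j + j').val)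
            (by rw [ZMod.val_add]; omega)]
  have hf : ∀ p q, f (mul p q) = f p * f q := by
    rintro ⟨i, j, k⟩ ⟨i', j', k'⟩
    rw [hm]
    simp only [hf_def]
    rcases zmod2_cases k with rfl | rfl <;> rcases zmod2_cases k' with rfl | rfl
    · -- `(rⁱ tʲ)(rⁱ' tʲ')`
      rw [if_pos rfl, if_neg (by decide), if_neg (by decide), add_zero, add_zero,
        show ((0 : ZMod 2) + 0) = 0 from rfl, hv0, pow_zero, mul_one, mul_one, mul_one]
      exact (hA i i' j j' (i + i') (by rw [ZMod.val_add]; omega)).symm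
    · -- `(rⁱ tʲ)(rⁱ' tʲ' x)`
      rw [if_pos rfl, if_neg (by decide), if_neg (by decide), add_zero, add_zero,
        show ((0 : ZMod 2) + 1) = 1 from rfl, hv0, hv1, pow_zero, pow_one, mul_one, ← mul_assoc,
        hA i i' j j' (i + i') (by rw [ZMod.val_add]; omega)]
    · -- `(rⁱ tʲ x)(rⁱ' tʲ')`
      rw [if_neg (by decide), if_neg (by decide), if_neg (by decide), add_zero, add_zero,
        show ((1 : ZMod 2) + 0) = 1 from rfl, hv0, hv1, pow_zero, pow_one, mul_one]
      symm
      calc r ^ i.val * t ^ j.val * x * (r ^ i'.val * t ^ j'.val)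
          = r ^ i.val * t ^ j.val * ((x * r ^ i'.val) * t ^ j'.val) := by simp only [mul_assoc]
        _ = r ^ i.val * t ^ j.val * ((r ^ (7 * i'.val) * x) * t ^ j'.val) := by rw [hxr']
        _ = r ^ i.val * t ^ j.val * (r ^ (7 * i'.val) * (x * t ^ j'.val)) := by simp only [mul_assoc]
        _ = r ^ i.val * t ^ j.val * (r ^ (7 * i'.val) * (t ^ j'.val * x)) := by rw [hxt']
        _ = r ^ i.val * t ^ j.val * (r ^ (7 * i').val * t ^ j'.val) * x := by
            rw [pow_eq_pow_of_mod_eq r hr8 (a := 7 * i'.val) (b := (7 * i').val) (hval7 i').symm]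
            simp only [mul_assoc]
        _ = r ^ (i + 7 * i').val * t ^ (j + j').val * x := by
            rw [hA i (7 * i') j j' (i + 7 * i') (by rw [ZMod.val_add]; omega)]
    · -- `(rⁱ tʲ x)(rⁱ' tʲ' x)`
      rw [if_neg (by decide), if_pos ⟨rfl, rfl⟩, if_pos ⟨rfl, rfl⟩,
        show ((1 : ZMod 2) + 1) = 0 from rfl, hv0, hv1, pow_zero, pow_one, mul_one]
      -- right-hand side: `rⁱ tʲ x rⁱ' tʲ' x = rⁱ tʲ r^{7i'} tʲ' (x x) = r^{i+7i'+a} t^{j+j'+b}`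
      have h1 : r ^ i.val * t ^ j.val * x * (r ^ i'.val * t ^ j'.val * x) =
          (r ^ i.val * t ^ j.val * (r ^ (7 * i'.val) * t ^ j'.val)) * (r ^ a.val * t ^ b.val) := by
        rw [← hxx]
        calc r ^ i.val * t ^ j.val * x * (r ^ i'.val * t ^ j'.val * x)
            = r ^ i.val * t ^ j.val * ((x * r ^ i'.val) * t ^ j'.val) * x := by simp only [mul_assoc]
          _ = r ^ i.val * t ^ j.val * ((r ^ (7 * i'.val) * x) * t ^ j'.val) * x := by rw [hxr']
          _ = r ^ i.val * t ^ j.val * (r ^ (7 * i'.val) * (x * t ^ j'.val)) * x := by simp only [mul_assoc]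
          _ = r ^ i.val * t ^ j.val * (r ^ (7 * i'.val) * (t ^ j'.val * x)) * x := by rw [hxt']
          _ = r ^ i.val * t ^ j.val * (r ^ (7 * i'.val) * t ^ j'.val) * (x * x) := by simp only [mul_assoc]
      rw [h1, ← pow_eq_pow_of_mod_eq r hr8 (a := (7 * i').val) (b := 7 * i'.val) (hval7 i'),
        hA i (7 * i') j j' (i + 7 * i') (by rw [ZMod.val_add]; omega),
        hA (i + 7 * i') a (j + j') b (i + 7 * i' + a) (by rw [ZMod.val_add]; omega)]
  have hker : ∀ p, f p = 1 → p = (0, 0, 0) := by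
    rintro ⟨i, j, k⟩ h
    simp only [hf_def] at h
    rcases zmod2_cases k with rfl | rfl
    · rw [hv0, pow_zero, mul_one] at h
      rcases zmod2_cases j with rfl | rfl
      · rw [hv0, pow_zero, mul_one] at h
        have hdvd : orderOf r ∣ i.val := orderOf_dvd_of_pow_eq_one h
        rw [hr] at hdvd
        have hi : i.val = 0 := by have := ZMod.val_lt i; omega
        rw [ZMod.val_eq_zero] at hi
        rw [hi]
      · exfalso
        rw [hv1, pow_one] at h
        apply htr
        have : t = (r ^ i.val)⁻¹ := eq_inv_of_mul_eq_one_right h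
        rw [this]
        exact Subgroup.inv_mem _ (Subgroup.pow_mem _ (Subgroup.mem_zpowers r) _)
    · exfalso
      rw [hv1, pow_one] at h
      exact hxA i.val j.val h
  have hfo : f (0, 0, 0) = 1 := by simp only [hf_def, hv0, ZMod.val_zero, pow_zero, mul_one]
  obtain ⟨e, he, hef⟩ := exists_table_equiv_of_words_inv mul (0, 0, 0) _ f hf hker hfo ho hlinv
    (by rw [hcard]; simp [ZMod.card])
  refine ⟨e, he, ?_, ?_, ?_, ?_, fun p => hef p⟩
  · have h := hef (1, 0, 0)
    simp only [hf_def, hv0, pow_zero, mul_one, show (1 : ZMod 8).val = 1 from rfl, pow_one] at h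
    exact h
  · have h := hef (0, 1, 0)
    simp only [hf_def, hv0, hv1, ZMod.val_zero, pow_zero, pow_one, mul_one, one_mul] at h
    exact h
  · have h := hef (0, 0, 1)
    simp only [hf_def, hv0, hv1, ZMod.val_zero, pow_zero, pow_one, mul_one, one_mul] at h
    exact h
  · rw [← hfo, hef]

end Summit.HodgeConjecture.CorCM.GaloisModels.CyclicEight
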